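import Mathlib
import Summits.Ventures.PercRepro2.Defs
import Summits.Ventures.PercRepro2.Graph
import Summits.Ventures.PercRepro2.MixedBoxDefs
import Summits.Ventures.PercRepro2.BTVFamilyCorollary
import Summits.Ventures.PercRepro2.BlockFamilyCorollary

/-!
# The role map: a pointwise coupling of the anti-v cells (blind cell PercRepro2, mine-1 g54)

Four observed vertices `u, v, w, y` and roots `s, t`; the four cells of the status law
(`cell4`, statuses `0 = T`, `1 = N`, `2 = S`):

* `a = (u N, v S, w T, y T) = cell4 … (1, 2, 0, 0)`,  `b = (u S, v T, w N, y S) = cell4 … (2, 0, 1, 2)`,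
* `j = (u S, v S, w N, y S) = cell4 … (2, 2, 1, 2)` (the join), `m = (u N, v T, w T, y T) = cell4 … (1, 0, 0, 0)`
  (the meet).

THE ROLE MAP. Given `ωa ∈ a` and `ωb ∈ b`, every edge open in exactly one of the two
configurations is sent to the MEET if it is on the `t`-side of its configuration and to the
JOIN if it is on the `s`-side: an `ωa`-only edge goes to the meet iff it lies in the cluster of `t`
in `ωa`; an `ωb`-only edge goes to the join iff it lies in the cluster of `s` in `ωb`; edges open
in both go to both.  The theorem `roleMap_mem` says the two configurations so built lie in
`m` and `j`.  Per edge the pair of outputs is the pair of inputs as a multiset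
(`meetCfg_add_joinCfg`), so the map preserves the product weight; it is not injective, which is
why the inequality `P(a)P(b) ≤ P(j)P(m)` does not follow from it directly (paper
proofs/MINE1-BLOCKS.md §2.5(e)–(h)).  The proof is the cluster argument of §2.5(e): the cluster
of `s` in the meet and the cluster of `t` in the join are the clusters through edges open in
both configurations, and the other clusters stay inside the unions that the roles prescribe.
-/

namespace Summit.Ventures.PercRepro2

namespace RoleMap

open MixedBox BTVFamily BlockFamily

variable {V : Type*} {E : Type*}

open Classical in
/-- An edge is on the `t`-side of `ω` if one of its endpoints is connected to `t`. -/
def tSide (ends : E → Sym2 V) (ω : Config E) (t : V) (e : E) : Prop :=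
  ∃ x ∈ ends e, Conn ends ω t x

open Classical in
/-- An edge is on the `s`-side of `ω` if one of its endpoints is connected to `s`. -/
def sSide (ends : E → Sym2 V) (ω : Config E) (s : V) (e : E) : Prop :=
  ∃ x ∈ ends e, Conn ends ω s x

open Classical in
/-- The meet configuration of the role map: edges open in both, `ωa`-only edges of the
`t`-side of `ωa`, and `ωb`-only edges off the `s`-side of `ωb`. -/
noncomputable def meetCfg (ends : E → Sym2 V) (s t : V) (ωa ωb : Config E) : Config E :=
  fun e => decide ((ωa e = true ∧ ωb e = true) ∨
    (ωa e = true ∧ ωb e = false ∧ tSide ends ωa t e) ∨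
    (ωa e = false ∧ ωb e = true ∧ ¬ sSide ends ωb s e))

open Classical in
/-- The join configuration of the role map: edges open in both, `ωb`-only edges of the
`s`-side of `ωb`, and `ωa`-only edges off the `t`-side of `ωa`. -/
noncomputable def joinCfg (ends : E → Sym2 V) (s t : V) (ωa ωb : Config E) : Config E :=
  fun e => decide ((ωa e = true ∧ ωb e = true) ∨
    (ωa e = true ∧ ωb e = false ∧ ¬ tSide ends ωa t e) ∨
    (ωa e = false ∧ ωb e = true ∧ sSide ends ωb s e))

variable (ends : E → Sym2 V) (s t : V) (ωa ωb : Config E)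

/-- Membership in the meet configuration. -/
lemma meetCfg_eq_true {e : E} : meetCfg ends s t ωa ωb e = true ↔
    (ωa e = true ∧ ωb e = true) ∨ (ωa e = true ∧ ωb e = false ∧ tSide ends ωa t e) ∨
    (ωa e = false ∧ ωb e = true ∧ ¬ sSide ends ωb s e) := by
  unfold meetCfg; simp only [decide_eq_true_eq]

/-- Membership in the join configuration. -/
lemma joinCfg_eq_true {e : E} : joinCfg ends s t ωa ωb e = true ↔
    (ωa e = true ∧ ωb e = true) ∨ (ωa e = true ∧ ωb e = false ∧ ¬ tSide ends ωa t e) ∨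
    (ωa e = false ∧ ωb e = true ∧ sSide ends ωb s e) := by
  unfold joinCfg; simp only [decide_eq_true_eq]

/-- The role map preserves the product weight edge by edge (i): both outputs are open at `e`
iff both inputs are. -/
lemma meetCfg_and_joinCfg (e : E) :
    (meetCfg ends s t ωa ωb e = true ∧ joinCfg ends s t ωa ωb e = true) ↔
      (ωa e = true ∧ ωb e = true) := by
  rw [meetCfg_eq_true, joinCfg_eq_true]
  by_cases ha : ωa e = true <;> by_cases hb : ωb e = true <;>
    by_cases ht : tSide ends ωa t e <;> by_cases hs : sSide ends ωb s e <;> simp_all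

/-- The role map preserves the product weight edge by edge (ii): some output is open at `e`
iff some input is. -/
lemma meetCfg_or_joinCfg (e : E) :
    (meetCfg ends s t ωa ωb e = true ∨ joinCfg ends s t ωa ωb e = true) ↔
      (ωa e = true ∨ ωb e = true) := by
  rw [meetCfg_eq_true, joinCfg_eq_true]
  by_cases ha : ωa e = true <;> by_cases hb : ωb e = true <;>
    by_cases ht : tSide ends ωa t e <;> by_cases hs : sSide ends ωb s e <;> simp_all

variable {ends s t ωa ωb}

/-- An open edge of a configuration connects its endpoints. -/
lemma conn_of_open {ω : Config E} {e : E} {x y : V} (he : ω e = true) (hxy : ends e = s(x, y)) :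
    Conn ends ω x y :=
  conn_of_openAdj ⟨e, he, hxy⟩

/-- If `e = s(x, y)` and some endpoint of `e` is connected to `r` in `ω`, and `e` is open in `ω`,
then both endpoints are connected to `r`. -/
lemma conn_both_of_side {ω : Config E} {e : E} {x y r : V} (he : ω e = true)
    (hxy : ends e = s(x, y)) (h : ∃ z ∈ ends e, Conn ends ω r z) :
    Conn ends ω r x ∧ Conn ends ω r y := by
  obtain ⟨z, hz, hrz⟩ := h
  have hc := conn_of_open he hxy
  rw [hxy, Sym2.mem_iff] at hz
  rcases hz with rfl | rfl
  · exact ⟨hrz, conn_trans hrz hc⟩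
  · exact ⟨conn_trans hrz (conn_symm hc), hrz⟩

/-- Open adjacency in the meet: the four kinds of edge. -/
lemma meet_adj_cases {x y : V} (h : (openGraph ends (meetCfg ends s t ωa ωb)).Adj x y) :
    (Conn ends ωa x y ∧ Conn ends ωb x y) ∨
    (Conn ends ωa x y ∧ Conn ends ωa t x ∧ Conn ends ωa t y) ∨
    (Conn ends ωb x y ∧ ¬ Conn ends ωb s x ∧ ¬ Conn ends ωb s y) := by
  rw [openGraph_adj] at h
  obtain ⟨-, e, he, hxy⟩ := h
  rw [meetCfg_eq_true] at he
  rcases he with ⟨ha, hb⟩ | ⟨ha, -, ht⟩ | ⟨-, hb, hs⟩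
  · exact Or.inl ⟨conn_of_open ha hxy, conn_of_open hb hxy⟩
  · exact Or.inr (Or.inl ⟨conn_of_open ha hxy, conn_both_of_side ha hxy ht⟩)
  · refine Or.inr (Or.inr ⟨conn_of_open hb hxy, ?_, ?_⟩)
    · intro hsx; exact hs ⟨x, by rw [hxy]; exact Sym2.mem_mk_left x y, hsx⟩
    · intro hsy; exact hs ⟨y, by rw [hxy]; exact Sym2.mem_mk_right x y, hsy⟩

/-- Open adjacency in the join: the four kinds of edge. -/
lemma join_adj_cases {x y : V} (h : (openGraph ends (joinCfg ends s t ωa ωb)).Adj x y) :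
    (Conn ends ωa x y ∧ Conn ends ωb x y) ∨
    (Conn ends ωa x y ∧ ¬ Conn ends ωa t x ∧ ¬ Conn ends ωa t y) ∨
    (Conn ends ωb x y ∧ Conn ends ωb s x ∧ Conn ends ωb s y) := by
  rw [openGraph_adj] at h
  obtain ⟨-, e, he, hxy⟩ := h
  rw [joinCfg_eq_true] at he
  rcases he with ⟨ha, hb⟩ | ⟨ha, -, ht⟩ | ⟨-, hb, hs⟩
  · exact Or.inl ⟨conn_of_open ha hxy, conn_of_open hb hxy⟩
  · refine Or.inr (Or.inl ⟨conn_of_open ha hxy, ?_, ?_⟩)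
    · intro htx; exact ht ⟨x, by rw [hxy]; exact Sym2.mem_mk_left x y, htx⟩
    · intro hty; exact ht ⟨y, by rw [hxy]; exact Sym2.mem_mk_right x y, hty⟩
  · exact Or.inr (Or.inr ⟨conn_of_open hb hxy, conn_both_of_side hb hxy hs⟩)

/-- The cluster of `s` in the meet lies in the clusters of `s` of both configurations
(on `s ↮ t` in `ωa`). -/
lemma meet_conn_s (hst : ¬ Conn ends ωa s t) {x : V}
    (h : Conn ends (meetCfg ends s t ωa ωb) s x) : Conn ends ωa s x ∧ Conn ends ωb s x := by
  refine mem_of_conn_of_closed (S := {x | Conn ends ωa s x ∧ Conn ends ωb s x}) ?_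
    ⟨conn_refl _ _ _, conn_refl _ _ _⟩ h
  intro x ⟨hax, hbx⟩ y hxy
  rcases meet_adj_cases hxy with ⟨ha, hb⟩ | ⟨-, htx, -⟩ | ⟨-, hsx, -⟩
  · exact ⟨conn_trans hax ha, conn_trans hbx hb⟩
  · exact absurd (conn_trans hax (conn_symm htx)) hst
  · exact absurd hbx hsx

/-- The cluster of `t` in the join lies in the clusters of `t` of both configurations
(on `s ↮ t` in `ωb`). -/
lemma join_conn_t (hst : ¬ Conn ends ωb s t) {x : V}
    (h : Conn ends (joinCfg ends s t ωa ωb) t x) : Conn ends ωa t x ∧ Conn ends ωb t x := by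
  refine mem_of_conn_of_closed (S := {x | Conn ends ωa t x ∧ Conn ends ωb t x}) ?_
    ⟨conn_refl _ _ _, conn_refl _ _ _⟩ h
  intro x ⟨hax, hbx⟩ y hxy
  rcases join_adj_cases hxy with ⟨ha, hb⟩ | ⟨-, htx, -⟩ | ⟨-, hsx, -⟩
  · exact ⟨conn_trans hax ha, conn_trans hbx hb⟩
  · exact absurd hax htx
  · exact absurd (conn_trans hsx (conn_symm hbx)) hst

/-- The cluster of `t` in the meet lies in `C_t(ωa) ∪ C_t(ωb) ∪ N(ωb)`. -/
lemma meet_conn_t {x : V} (h : Conn ends (meetCfg ends s t ωa ωb) t x) :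
    Conn ends ωa t x ∨ Conn ends ωb t x ∨ (¬ Conn ends ωb s x ∧ ¬ Conn ends ωb t x) := by
  refine mem_of_conn_of_closed
    (S := {x | Conn ends ωa t x ∨ Conn ends ωb t x ∨ (¬ Conn ends ωb s x ∧ ¬ Conn ends ωb t x)})
    ?_ (Or.inl (conn_refl _ _ _)) h
  intro x hx y hxy
  rcases meet_adj_cases hxy with ⟨ha, hb⟩ | ⟨-, -, hty⟩ | ⟨hb, hsx, hsy⟩
  · rcases hx with hax | hbx | ⟨hnsx, hntx⟩
    · exact Or.inl (conn_trans hax ha)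
    · exact Or.inr (Or.inl (conn_trans hbx hb))
    · exact Or.inr (Or.inr ⟨fun hsy => hnsx (conn_trans hsy (conn_symm hb)),
        fun hty => hntx (conn_trans hty (conn_symm hb))⟩)
  · exact Or.inl hty
  · by_cases hty : Conn ends ωb t y
    · exact Or.inr (Or.inl hty)
    · exact Or.inr (Or.inr ⟨hsy, hty⟩)

/-- The cluster of `s` in the join lies in `C_s(ωa) ∪ C_s(ωb) ∪ N(ωa)`. -/
lemma join_conn_s {x : V} (h : Conn ends (joinCfg ends s t ωa ωb) s x) :
    Conn ends ωa s x ∨ Conn ends ωb s x ∨ (¬ Conn ends ωa s x ∧ ¬ Conn ends ωa t x) := by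
  refine mem_of_conn_of_closed
    (S := {x | Conn ends ωa s x ∨ Conn ends ωb s x ∨ (¬ Conn ends ωa s x ∧ ¬ Conn ends ωa t x)})
    ?_ (Or.inl (conn_refl _ _ _)) h
  intro x hx y hxy
  rcases join_adj_cases hxy with ⟨ha, hb⟩ | ⟨ha, htx, hty⟩ | ⟨-, -, hsy⟩
  · rcases hx with hax | hbx | ⟨hnsx, hntx⟩
    · exact Or.inl (conn_trans hax ha)
    · exact Or.inr (Or.inl (conn_trans hbx hb))
    · exact Or.inr (Or.inr ⟨fun hsy => hnsx (conn_trans hsy (conn_symm ha)),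
        fun hty => hntx (conn_trans hty (conn_symm ha))⟩)
  · by_cases hsy : Conn ends ωa s y
    · exact Or.inl hsy
    · exact Or.inr (Or.inr ⟨hsy, hty⟩)
  · exact Or.inr (Or.inl hsy)

/-- The `t`-side of `ωa` survives in the meet: `t ↔ x` in `ωa` gives `t ↔ x` in the meet. -/
lemma meet_conn_t_of_a {x : V} (h : Conn ends ωa t x) : Conn ends (meetCfg ends s t ωa ωb) t x := by
  refine mem_of_conn_of_closed (ω := ωa)
    (S := {x | Conn ends ωa t x → Conn ends (meetCfg ends s t ωa ωb) t x}) ?_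
    (fun _ => conn_refl _ _ _) h h
  intro x hx y hxy hty
  rw [openGraph_adj] at hxy
  obtain ⟨hne, e, he, hxy⟩ := hxy
  have hc := conn_of_open he hxy
  have htx : Conn ends ωa t x := conn_trans hty (conn_symm hc)
  have hm : meetCfg ends s t ωa ωb e = true := by
    rw [meetCfg_eq_true]
    by_cases hb : ωb e = true
    · exact Or.inl ⟨he, hb⟩
    · exact Or.inr (Or.inl ⟨he, by simpa using hb, ⟨x, by rw [hxy]; exact Sym2.mem_mk_left x y, htx⟩⟩)
  exact conn_trans (hx htx) (conn_of_openAdj ⟨e, hm, hxy⟩)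

/-- The `t`-side of `ωb` survives in the meet (on `s ↮ t` in `ωb`). -/
lemma meet_conn_t_of_b (hst : ¬ Conn ends ωb s t) {x : V} (h : Conn ends ωb t x) :
    Conn ends (meetCfg ends s t ωa ωb) t x := by
  refine mem_of_conn_of_closed (ω := ωb)
    (S := {x | Conn ends ωb t x → Conn ends (meetCfg ends s t ωa ωb) t x}) ?_
    (fun _ => conn_refl _ _ _) h h
  intro x hx y hxy hty
  rw [openGraph_adj] at hxy
  obtain ⟨hne, e, he, hxy⟩ := hxy
  have hc := conn_of_open he hxy
  have htx : Conn ends ωb t x := conn_trans hty (conn_symm hc)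
  have hm : meetCfg ends s t ωa ωb e = true := by
    rw [meetCfg_eq_true]
    by_cases ha : ωa e = true
    · exact Or.inl ⟨ha, he⟩
    · refine Or.inr (Or.inr ⟨by simpa using ha, he, ?_⟩)
      rintro ⟨z, hz, hsz⟩
      rw [hxy, Sym2.mem_iff] at hz
      rcases hz with rfl | rfl
      · exact hst (conn_trans hsz (conn_symm htx))
      · exact hst (conn_trans hsz (conn_symm hty))
  exact conn_trans (hx htx) (conn_of_openAdj ⟨e, hm, hxy⟩)

/-- The `s`-side of `ωb` survives in the join. -/
lemma join_conn_s_of_b {x : V} (h : Conn ends ωb s x) : Conn ends (joinCfg ends s t ωa ωb) s x := by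
  refine mem_of_conn_of_closed (ω := ωb)
    (S := {x | Conn ends ωb s x → Conn ends (joinCfg ends s t ωa ωb) s x}) ?_
    (fun _ => conn_refl _ _ _) h h
  intro x hx y hxy hsy
  rw [openGraph_adj] at hxy
  obtain ⟨hne, e, he, hxy⟩ := hxy
  have hc := conn_of_open he hxy
  have hsx : Conn ends ωb s x := conn_trans hsy (conn_symm hc)
  have hm : joinCfg ends s t ωa ωb e = true := by
    rw [joinCfg_eq_true]
    by_cases ha : ωa e = true
    · exact Or.inl ⟨ha, he⟩
    · exact Or.inr (Or.inr ⟨by simpa using ha, he, ⟨x, by rw [hxy]; exact Sym2.mem_mk_left x y, hsx⟩⟩)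
  exact conn_trans (hx hsx) (conn_of_openAdj ⟨e, hm, hxy⟩)

/-- The `s`-side of `ωa` survives in the join (on `s ↮ t` in `ωa`). -/
lemma join_conn_s_of_a (hst : ¬ Conn ends ωa s t) {x : V} (h : Conn ends ωa s x) :
    Conn ends (joinCfg ends s t ωa ωb) s x := by
  refine mem_of_conn_of_closed (ω := ωa)
    (S := {x | Conn ends ωa s x → Conn ends (joinCfg ends s t ωa ωb) s x}) ?_
    (fun _ => conn_refl _ _ _) h h
  intro x hx y hxy hsy
  rw [openGraph_adj] at hxy
  obtain ⟨hne, e, he, hxy⟩ := hxy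
  have hc := conn_of_open he hxy
  have hsx : Conn ends ωa s x := conn_trans hsy (conn_symm hc)
  have hm : joinCfg ends s t ωa ωb e = true := by
    rw [joinCfg_eq_true]
    by_cases hb : ωb e = true
    · exact Or.inl ⟨he, hb⟩
    · refine Or.inr (Or.inl ⟨he, by simpa using hb, ?_⟩)
      rintro ⟨z, hz, htz⟩
      rw [hxy, Sym2.mem_iff] at hz
      rcases hz with rfl | rfl
      · exact hst (conn_trans hsx (conn_symm htz))
      · exact hst (conn_trans hsy (conn_symm htz))
  exact conn_trans (hx hsx) (conn_of_openAdj ⟨e, hm, hxy⟩)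

section Cells

variable [Fintype E] [Fintype V] [DecidableEq V]

/-- **The role map is a pointwise coupling of the anti-v cells.** For `ωa ∈ (u N, v S, w T, y T)`
and `ωb ∈ (u S, v T, w N, y S)`, the meet configuration lies in `(u N, v T, w T, y T)` and the
join configuration in `(u S, v S, w N, y S)`. -/
theorem roleMap_mem (u v w y : V)
    (ha : ωa ∈ cell4 ends s t u v w y (1, 2, 0, 0))
    (hb : ωb ∈ cell4 ends s t u v w y (2, 0, 1, 2)) :
    meetCfg ends s t ωa ωb ∈ cell4 ends s t u v w y (1, 0, 0, 0) ∧
      joinCfg ends s t ωa ωb ∈ cell4 ends s t u v w y (2, 2, 1, 2) := by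
  simp only [cell4, Set.mem_setOf_eq, status_eq_zero_iff, status_eq_one_iff,
    status_eq_two_iff] at ha hb ⊢
  obtain ⟨⟨hau_s, hau_t⟩, hav, ⟨haw_s, haw_t⟩, ⟨hay_s, hay_t⟩, hast⟩ := ha
  obtain ⟨hbu, ⟨hbv_s, hbv_t⟩, ⟨hbw_s, hbw_t⟩, hby, hbst⟩ := hb
  -- consequences of s ↮ t
  have hbu_t : ¬ Conn ends ωb t u := fun h => hbst (conn_trans hbu (conn_symm h))
  have hby_t : ¬ Conn ends ωb t y := fun h => hbst (conn_trans hby (conn_symm h))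
  have hav_t : ¬ Conn ends ωa t v := fun h => hast (conn_trans hav (conn_symm h))
  refine ⟨⟨⟨?_, ?_⟩, ⟨?_, ?_⟩, ⟨?_, ?_⟩, ⟨?_, ?_⟩, ?_⟩, ⟨?_, ?_, ⟨?_, ?_⟩, ?_, ?_⟩⟩
  -- meet: u N
  · intro h; exact hau_s (meet_conn_s hast h).1
  · intro h
    rcases meet_conn_t h with h1 | h2 | ⟨h3, -⟩
    · exact hau_t h1
    · exact hbu_t h2
    · exact h3 hbu
  -- meet: v T
  · intro h; exact hbv_s (meet_conn_s hast h).2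
  · exact meet_conn_t_of_b hbst hbv_t
  -- meet: w T
  · intro h; exact haw_s (meet_conn_s hast h).1
  · exact meet_conn_t_of_a haw_t
  -- meet: y T
  · intro h; exact hay_s (meet_conn_s hast h).1
  · exact meet_conn_t_of_a hay_t
  -- meet: s ↮ t
  · intro h; exact hast (meet_conn_s hast h).1
  -- join: u S
  · exact join_conn_s_of_b hbu
  -- join: v S
  · exact join_conn_s_of_a hast hav
  -- join: w N
  · intro h
    rcases join_conn_s h with h1 | h2 | ⟨-, h3⟩
    · exact haw_s h1
    · exact hbw_s h2
    · exact h3 haw_t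
  · intro h; exact hbw_t (join_conn_t hbst h).2
  -- join: y S
  · exact join_conn_s_of_b hby
  -- join: s ↮ t
  · intro h
    rcases join_conn_s h with h1 | h2 | ⟨-, h3⟩
    · exact hast h1
    · exact hbst h2
    · exact h3 (conn_refl _ _ _)

/-- The same statement in the registry's join/meet notation: the role map sends
`cell4 a × cell4 b` into `cell4 (cellJoin4 a b) × cell4 (cellMeet4 a b)` for the anti-v pair
`a = (1,2,0,0)`, `b = (2,0,1,2)`. -/
theorem roleMap_mem_joinMeet (u v w y : V)
    (ha : ωa ∈ cell4 ends s t u v w y (1, 2, 0, 0))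
    (hb : ωb ∈ cell4 ends s t u v w y (2, 0, 1, 2)) :
    joinCfg ends s t ωa ωb ∈ cell4 ends s t u v w y (cellJoin4 (1, 2, 0, 0) (2, 0, 1, 2)) ∧
      meetCfg ends s t ωa ωb ∈ cell4 ends s t u v w y (cellMeet4 (1, 2, 0, 0) (2, 0, 1, 2)) := by
  have h := roleMap_mem u v w y ha hb
  exact ⟨by simpa [cellJoin4] using h.2, by simpa [cellMeet4] using h.1⟩

end Cells

end RoleMap

end Summit.Ventures.PercRepro2
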